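import Literature.AlgebraicGeometry.HodgeTheory.AbelianVarietyIsotypicSubvarieties
import Literature.AlgebraicGeometry.Motives.AbelianVarietyQuasiSectionPerfectField
import Literature.AlgebraicGeometry.Motives.AbelianVarietyEndAlgebraProdOfHomEqZero
import Literature.AlgebraicGeometry.Motives.AbelianVarietySimpleFactorsUnique
import HarnessLib

/-!
# `Hom(X, X') = 0` iff `X` and `X'` have no isogenous simple factors; `Hom`-orthogonality is symmetric
# (perfect field; Mumford §19 Cor. 1–2, Milne §12, Lange Cor. 2.4.26)

Layer `Literature/AlgebraicGeometry/HodgeTheory`; theorems only (no `def`, no instance, no named fact; net debt 0).  §1 holds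
over ANY field; §§2–3 over a PERFECT field (orthogonality of isotypic abelian varieties of non-isogenous types,
`HodgeTheory/AbelianVarietyIsotypicSubvarieties`, and the isotypic decomposition
`Motives.AbelianVariety.exists_isIsogenous_biproduct_powers_of_perfectField`).  The tree has the criterion and the symmetry
over `ℂ` through `H¹_B` (`HodgeTheory/AbelianVarietyHOneHomMultiplicityFormula.forall_hom_eq_zero_comm`); here they are
proved algebraically over every perfect field.

THE PRINT.  Mumford, *Abelian Varieties* §19 Cor. 1–2 of Thm. 1 (pp. 173–174): `X ∼ ∏ X_i^{n_i}` with `X_i` simple pairwise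
non-isogenous, unique up to isogeny, and `End⁰(X) = ⊕ M_{n_i}(D_i)` — no non-zero homomorphisms between non-isogenous
blocks; Milne 1986 §12 p. 122 (PDF p. 189): «`Hom(A, B) = 0` if `A` and `B` are simple and non-isogenous …
`End⁰(A) = ∏ End⁰(A_i^{r_i})`»; Lange 2023 Cor. 2.4.26 (proof, PDF p. 124): «Since `Hom(X_ν^{n_ν}, X_μ^{n_μ}) = 0` for
`ν ≠ μ` …».

THE ARGUMENT.  §1: `Hom(X, X') = 0` is invariant under isogenies of `X` and of `X'` (epimorphy of isogenies, quasi-inverses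
`[n]`, torsion-freeness of `Hom`).  §2: for `X = ⨁_q B_q^{n_q+1}`, `X' = ⨁_{q'} B'_{q'}^{n'_{q'}+1}` with simple `B_q`, `B'_{q'}` of
positive dimension: if no `B_q ∼ B'_{q'}`, every component `B_q^{n_q+1} → B'^{n'+1}_{q'}` of a homomorphism vanishes
(`hom_eq_zero_of_isotypic_of_not_isIsogenous`), so `Hom = 0`; if `φ : B_q → B'_{q'}` is an isogeny, the homomorphism
`π_q π_0 φ ι_0 ι_{q'}` is non-zero because composing back with `ι_q ι_0` and `π_{q'} π_0` recovers `φ ≠ 0`.  §3: transport to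
arbitrary `X ∼ ⨁ B_q^{n_q+1}`, `X' ∼ ⨁ B'^{n'+1}` (§1); the criterion is symmetric in `(X, X')` since isogeny is, whence
`Hom(X, X') = 0 ⟺ Hom(X', X) = 0`, and one-sided orthogonality already splits `End⁰(X ⊞ X') ≅ End⁰(X) × End⁰(X')`.

Results (namespace `Literature.AlgebraicGeometry.HodgeTheory.AbelianVariety`):
* §1 (any field) `forall_hom_eq_zero_of_isIsogeny_source`, `forall_hom_eq_zero_of_isIsogeny_to_source`,
  `forall_hom_eq_zero_of_isIsogeny_target`, `forall_hom_eq_zero_of_isIsogeny_to_target`,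
  **`forall_hom_eq_zero_iff_of_isIsogenous`** (`X ∼ X₁`, `X' ∼ X₁'` ⟹ (`Hom(X, X') = 0 ⟺ Hom(X₁, X₁') = 0`));
* §2 `comp_hom_biproduct_pow_eq` (extracting the `(q, q')` block), `exists_hom_biproduct_pow_ne_zero_of_isIsogenous` (any
  field), `hom_biproduct_pow_eq_zero_of_forall_not_isIsogenous`, **`forall_hom_biproduct_pow_eq_zero_iff`** (perfect field);
* §3 (perfect field) **`forall_hom_eq_zero_iff_forall_not_isIsogenous_of_isIsogenous`** (`Hom(X, X') = 0 ⟺ ∀ q q',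
  ¬ B_q ∼ B'_{q'}` for any decompositions `X ∼ ⨁ B_q^{n_q+1}`, `X' ∼ ⨁ B'^{n'+1}_{q'}` into simple factors),
  **`forall_hom_eq_zero_comm_of_perfectField`** (`Hom(X, X') = 0 ⟺ Hom(X', X) = 0`), `subsingleton_hom_comm_of_perfectField`,
  **`nonempty_algEquiv_endAlgebra_biprod_prod_of_forall_hom_eq_zero`** (`Hom(X, X') = 0 ⟹ End⁰(X ⊞ X') ≃ₐ[ℚ]
  End⁰(X) × End⁰(X')`), `finrank_endAlgebra_biprod_of_forall_hom_eq_zero`.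

## References
* [MumfordAV1970] D. Mumford, *Abelian Varieties* (1970), §19 Thm. 1, Cor. 1–2, Remark p. 169 and Thm. 3 (pp. 169–176).
* [Milne1986AbelianVarieties] J. S. Milne, *Abelian Varieties*, in Cornell–Silverman, *Arithmetic Geometry* (1986), §12
  Prop. 12.1 and p. 122 (PDF p. 189).
* [Lange2023AbelianVarietiesComplex] H. Lange, *Abelian Varieties over the Complex Numbers* (2023), §2.4.4 Thm. 2.4.25 and
  Cor. 2.4.26 with proof (PDF pp. 123–124).
* [GortzWedhorn2023] U. Görtz, T. Wedhorn, *Algebraic Geometry II* (2023), Prop. 27.178 (1) (isogenies are epimorphisms).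
-/

noncomputable section

universe u

open CategoryTheory CategoryTheory.Limits

namespace Literature.AlgebraicGeometry.HodgeTheory

namespace AbelianVariety

open _root_.AlgebraicGeometry
open Literature.AlgebraicGeometry.Motives Literature.AlgebraicGeometry.Motives.AbelianVariety

variable {K : Type u} [Field K]

/-! ## §1 `Hom(X, X') = 0` is an isogeny invariant of `X` and of `X'` (any field) -/

section Transport

variable {X X₁ X' X₁' : Motives.AbelianVariety K}

/-- `Hom(X, X') = 0` and `u : X → X₁` an isogeny ⟹ `Hom(X₁, X') = 0` (`u` is an epimorphism).
[cite: GortzWedhorn2023, Prop. 27.178 (1)] [cite: MumfordAV1970, §19 Remark p. 169] -/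
theorem forall_hom_eq_zero_of_isIsogeny_source {u : X ⟶ X₁} (hu : IsIsogeny u) (h : ∀ f : X ⟶ X', f = 0) :
    ∀ g : X₁ ⟶ X', g = 0 := fun g ↦
  hu.cancel_left (by rw [h (u ≫ g), comp_zero])

/-- `Hom(X₁, X') = 0` and `u : X → X₁` an isogeny ⟹ `Hom(X, X') = 0` (`n • f = u ≫ v ≫ f = 0` for a quasi-inverse `v`, and
`Hom` is torsion-free). [cite: MumfordAV1970, §19 Remark p. 169 and Thm. 3 (p. 176)] -/
theorem forall_hom_eq_zero_of_isIsogeny_to_source {u : X ⟶ X₁} (hu : IsIsogeny u) (h : ∀ g : X₁ ⟶ X', g = 0) :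
    ∀ f : X ⟶ X', f = 0 := fun f ↦ by
  obtain ⟨v, n, hn, huv, -⟩ := IsIsogeny.exists_nsmul_inverse_holds hu
  refine hom_eq_zero_of_nsmul_eq_zero hn.ne' ?_
  calc n • f = (u ≫ v) ≫ f := by rw [huv, Preadditive.nsmul_comp, Category.id_comp]
    _ = 0 := by rw [Category.assoc, h (v ≫ f), comp_zero]

/-- `Hom(X, X') = 0` and `u' : X' → X₁'` an isogeny ⟹ `Hom(X, X₁') = 0` (`n • g = g ≫ v' ≫ u' = 0`).
[cite: MumfordAV1970, §19 Remark p. 169 and Thm. 3 (p. 176)] -/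
theorem forall_hom_eq_zero_of_isIsogeny_target {u' : X' ⟶ X₁'} (hu' : IsIsogeny u') (h : ∀ f : X ⟶ X', f = 0) :
    ∀ g : X ⟶ X₁', g = 0 := fun g ↦ by
  obtain ⟨v', n, hn, -, hvu⟩ := IsIsogeny.exists_nsmul_inverse_holds hu'
  refine hom_eq_zero_of_nsmul_eq_zero hn.ne' ?_
  calc n • g = g ≫ (v' ≫ u') := by rw [hvu, Preadditive.comp_nsmul, Category.comp_id]
    _ = 0 := by rw [← Category.assoc, h (g ≫ v'), zero_comp]

/-- `Hom(X, X₁') = 0` and `u' : X' → X₁'` an isogeny ⟹ `Hom(X, X') = 0` (`n • f = f ≫ u' ≫ v' = 0`).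
[cite: MumfordAV1970, §19 Remark p. 169 and Thm. 3 (p. 176)] -/
theorem forall_hom_eq_zero_of_isIsogeny_to_target {u' : X' ⟶ X₁'} (hu' : IsIsogeny u') (h : ∀ g : X ⟶ X₁', g = 0) :
    ∀ f : X ⟶ X', f = 0 := fun f ↦ by
  obtain ⟨v', n, hn, huv, -⟩ := IsIsogeny.exists_nsmul_inverse_holds hu'
  refine hom_eq_zero_of_nsmul_eq_zero hn.ne' ?_
  calc n • f = f ≫ (u' ≫ v') := by rw [huv, Preadditive.comp_nsmul, Category.comp_id]
    _ = 0 := by rw [← Category.assoc, h (f ≫ u'), zero_comp]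

/-- **`Hom(X, X') = 0` is an isogeny invariant**: `X ∼ X₁`, `X' ∼ X₁'` ⟹ (`Hom(X, X') = 0 ⟺ Hom(X₁, X₁') = 0`) (any
field). [cite: MumfordAV1970, §19 Remark p. 169 and Thm. 3 (p. 176)] [cite: Milne1986AbelianVarieties, §12 p. 122 (PDF p. 189)] -/
theorem forall_hom_eq_zero_iff_of_isIsogenous (h₁ : IsIsogenous X X₁) (h₂ : IsIsogenous X' X₁') :
    (∀ f : X ⟶ X', f = 0) ↔ ∀ f : X₁ ⟶ X₁', f = 0 := by
  obtain ⟨u, hu⟩ := h₁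
  obtain ⟨u', hu'⟩ := h₂
  exact ⟨fun h ↦ forall_hom_eq_zero_of_isIsogeny_target hu' (forall_hom_eq_zero_of_isIsogeny_source hu h),
    fun h ↦ forall_hom_eq_zero_of_isIsogeny_to_source hu (forall_hom_eq_zero_of_isIsogeny_to_target hu' h)⟩

end Transport

/-! ## §2 The criterion for products of powers of simple abelian varieties -/

section Powers

variable {Q Q' : Type} [Fintype Q] [Fintype Q'] {B : Q → Motives.AbelianVariety K} {B' : Q' → Motives.AbelianVariety K}
  {n : Q → ℕ} {n' : Q' → ℕ}

/-- Extracting the `(q, k; q', k')` block of a homomorphism between products of powers: for the block homomorphism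
`F = π_q ≫ π_k ≫ φ ≫ ι_{k'} ≫ ι_{q'}` one recovers `ι_q ι_k F π_{q'} π_{k'} = φ`. [cite: MumfordAV1970, §19 Cor. 2 of Thm. 1 (p. 174)] -/
theorem comp_hom_biproduct_pow_eq (q : Q) (k : Fin (n q + 1)) (q' : Q') (k' : Fin (n' q' + 1)) (φ : B q ⟶ B' q') :
    (biproduct.ι (fun q ↦ ⨁ fun _ : Fin (n q + 1) ↦ B q) q ≫
      (biproduct.π (fun q ↦ ⨁ fun _ : Fin (n q + 1) ↦ B q) q ≫ biproduct.π (fun _ : Fin (n q + 1) ↦ B q) k ≫ φ ≫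
        biproduct.ι (fun _ : Fin (n' q' + 1) ↦ B' q') k' ≫ biproduct.ι (fun q' ↦ ⨁ fun _ : Fin (n' q' + 1) ↦ B' q') q') ≫
      biproduct.π (fun q' ↦ ⨁ fun _ : Fin (n' q' + 1) ↦ B' q') q') =
      biproduct.π (fun _ : Fin (n q + 1) ↦ B q) k ≫ φ ≫ biproduct.ι (fun _ : Fin (n' q' + 1) ↦ B' q') k' := by
  simp only [Category.assoc, biproduct.ι_π_self, Category.comp_id, biproduct.ι_π_self_assoc]

/-- **A common simple factor gives a non-zero homomorphism** (any field): if `B_q ∼ B'_{q'}` with `0 < dim B_q`, then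
`Hom(⨁_q B_q^{n_q+1}, ⨁_{q'} B'^{n'_{q'}+1}_{q'}) ≠ 0`. [cite: MumfordAV1970, §19 Cor. 1–2 of Thm. 1 (pp. 173–174)]
[cite: Milne1986AbelianVarieties, §12 p. 122 (PDF p. 189)] -/
theorem exists_hom_biproduct_pow_ne_zero_of_isIsogenous {q : Q} {q' : Q'} (hqq' : IsIsogenous (B q) (B' q'))
    (hB0 : 0 < (B q).dim) :
    ∃ f : (⨁ fun q ↦ ⨁ fun _ : Fin (n q + 1) ↦ B q) ⟶ (⨁ fun q' ↦ ⨁ fun _ : Fin (n' q' + 1) ↦ B' q'), f ≠ 0 := by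
  obtain ⟨φ, hφ⟩ := hqq'
  haveI : IsFinite (Hom.toSchemeHom φ) := hφ.2
  have hφ0 : φ ≠ 0 := ne_zero_of_isFinite φ hB0
  refine ⟨biproduct.π (fun q ↦ ⨁ fun _ : Fin (n q + 1) ↦ B q) q ≫ biproduct.π (fun _ : Fin (n q + 1) ↦ B q) 0 ≫ φ ≫
    biproduct.ι (fun _ : Fin (n' q' + 1) ↦ B' q') 0 ≫ biproduct.ι (fun q' ↦ ⨁ fun _ : Fin (n' q' + 1) ↦ B' q') q',
    fun h ↦ hφ0 ?_⟩
  have h' := comp_hom_biproduct_pow_eq (n := n) (n' := n') q 0 q' 0 φ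
  rw [h, zero_comp, comp_zero] at h'
  -- `π_0 ≫ φ ≫ ι_0 = 0` ⟹ `φ = ι_0 ≫ (π_0 ≫ φ ≫ ι_0) ≫ π_0 = 0`
  have hφ' : φ = biproduct.ι (fun _ : Fin (n q + 1) ↦ B q) 0 ≫
      (biproduct.π (fun _ : Fin (n q + 1) ↦ B q) 0 ≫ φ ≫ biproduct.ι (fun _ : Fin (n' q' + 1) ↦ B' q') 0) ≫
        biproduct.π (fun _ : Fin (n' q' + 1) ↦ B' q') 0 := by
    simp only [Category.assoc, biproduct.ι_π_self, Category.comp_id, biproduct.ι_π_self_assoc]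
  rw [hφ', ← h', zero_comp, comp_zero]

variable [PerfectField K]

/-- **No isogenous simple factors ⟹ every homomorphism between the products of powers vanishes** (perfect field): the
`(q, q')` blocks are homomorphisms `B_q^{n_q+1} → B'^{n'_{q'}+1}_{q'}` between isotypic abelian varieties of non-isogenous
types. [cite: MumfordAV1970, §19 Cor. 2 of Thm. 1 (p. 174)] [cite: Lange2023AbelianVarietiesComplex, §2.4.4 Cor. 2.4.26 with proof (PDF p. 124)]
[cite: Milne1986AbelianVarieties, §12 p. 122 (PDF p. 189)] -/
theorem hom_biproduct_pow_eq_zero_of_forall_not_isIsogenous (hB : ∀ q, (B q).IsSimple) (hB0 : ∀ q, 0 < (B q).dim)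
    (hB' : ∀ q', (B' q').IsSimple) (hB0' : ∀ q', 0 < (B' q').dim) (hni : ∀ q q', ¬ IsIsogenous (B q) (B' q'))
    (f : (⨁ fun q ↦ ⨁ fun _ : Fin (n q + 1) ↦ B q) ⟶ (⨁ fun q' ↦ ⨁ fun _ : Fin (n' q' + 1) ↦ B' q')) : f = 0 :=
  biproduct.hom_ext' _ _ fun q ↦ biproduct.hom_ext _ _ fun q' ↦ by
    rw [Category.assoc, comp_zero, zero_comp]
    exact hom_eq_zero_of_isotypic_of_not_isIsogenous (hB q) (hB0 q) (hB' q') (hB0' q') (IsIsogenous.refl _)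
      (IsIsogenous.refl _) (hni q q') _

/-- **`Hom(⨁_q B_q^{n_q+1}, ⨁_{q'} B'^{n'_{q'}+1}_{q'}) = 0` iff no `B_q` is isogenous to a `B'_{q'}`** (simple factors of
positive dimension; perfect field). [cite: MumfordAV1970, §19 Cor. 1–2 of Thm. 1 (pp. 173–174)]
[cite: Lange2023AbelianVarietiesComplex, §2.4.4 Cor. 2.4.26 with proof (PDF p. 124)] [cite: Milne1986AbelianVarieties, §12 p. 122 (PDF p. 189)] -/
theorem forall_hom_biproduct_pow_eq_zero_iff (hB : ∀ q, (B q).IsSimple) (hB0 : ∀ q, 0 < (B q).dim)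
    (hB' : ∀ q', (B' q').IsSimple) (hB0' : ∀ q', 0 < (B' q').dim) :
    (∀ f : (⨁ fun q ↦ ⨁ fun _ : Fin (n q + 1) ↦ B q) ⟶ (⨁ fun q' ↦ ⨁ fun _ : Fin (n' q' + 1) ↦ B' q'), f = 0) ↔
      ∀ q q', ¬ IsIsogenous (B q) (B' q') := by
  refine ⟨fun h q q' hqq' ↦ ?_, fun hni f ↦ hom_biproduct_pow_eq_zero_of_forall_not_isIsogenous hB hB0 hB' hB0' hni f⟩
  obtain ⟨f, hf⟩ := exists_hom_biproduct_pow_ne_zero_of_isIsogenous (n := n) (n' := n') hqq' (hB0 q)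
  exact hf (h f)

end Powers

/-! ## §3 The criterion and the symmetry for arbitrary abelian varieties over a perfect field -/

section Perfect

variable [PerfectField K] {Q Q' : Type} [Fintype Q] [Fintype Q'] {B : Q → Motives.AbelianVariety K}
  {B' : Q' → Motives.AbelianVariety K} {n : Q → ℕ} {n' : Q' → ℕ} {X X' : Motives.AbelianVariety K}

/-- **`Hom(X, X') = 0` IFF NO SIMPLE FACTOR OF `X` IS ISOGENOUS TO A SIMPLE FACTOR OF `X'`** (perfect field), for any
decompositions `X ∼ ⨁_q B_q^{n_q+1}`, `X' ∼ ⨁_{q'} B'^{n'_{q'}+1}_{q'}` into powers of simple abelian varieties of positive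
dimension (`Hom(X, X') = 0` is an isogeny invariant, §1, and the criterion for the products, §2).
[cite: MumfordAV1970, §19 Cor. 1–2 of Thm. 1 (pp. 173–174)] [cite: Milne1986AbelianVarieties, §12 Prop. 12.1 and p. 122 (PDF p. 189)]
[cite: Lange2023AbelianVarietiesComplex, §2.4.4 Cor. 2.4.26 with proof (PDF p. 124)] -/
theorem forall_hom_eq_zero_iff_forall_not_isIsogenous_of_isIsogenous (hB : ∀ q, (B q).IsSimple)
    (hB0 : ∀ q, 0 < (B q).dim) (hB' : ∀ q', (B' q').IsSimple) (hB0' : ∀ q', 0 < (B' q').dim)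
    (hX : IsIsogenous X (⨁ fun q ↦ ⨁ fun _ : Fin (n q + 1) ↦ B q))
    (hX' : IsIsogenous X' (⨁ fun q' ↦ ⨁ fun _ : Fin (n' q' + 1) ↦ B' q')) :
    (∀ f : X ⟶ X', f = 0) ↔ ∀ q q', ¬ IsIsogenous (B q) (B' q') := by
  rw [forall_hom_eq_zero_iff_of_isIsogenous hX hX']
  exact forall_hom_biproduct_pow_eq_zero_iff hB hB0 hB' hB0'

/-- **`Hom`-ORTHOGONALITY IS SYMMETRIC: `Hom(X, X') = 0 ⟺ Hom(X', X) = 0`** for abelian varieties over a perfect field (both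
say that `X` and `X'` have no isogenous simple factors; the tree's `forall_hom_eq_zero_comm` is the case `K = ℂ`, through
`H¹_B`). [cite: MumfordAV1970, §19 Cor. 1–2 of Thm. 1 (pp. 173–174)] [cite: Milne1986AbelianVarieties, §12 Prop. 12.1 and p. 122 (PDF p. 189)] -/
theorem forall_hom_eq_zero_comm_of_perfectField (X X' : Motives.AbelianVariety K) :
    (∀ f : X ⟶ X', f = 0) ↔ ∀ g : X' ⟶ X, g = 0 := by
  obtain ⟨Q, _, _, B, n, hB, hB0, -, hX⟩ := exists_isIsogenous_biproduct_powers_of_perfectField X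
  obtain ⟨Q', _, _, B', n', hB', hB0', -, hX'⟩ := exists_isIsogenous_biproduct_powers_of_perfectField X'
  rw [forall_hom_eq_zero_iff_forall_not_isIsogenous_of_isIsogenous hB hB0 hB' hB0' hX hX',
    forall_hom_eq_zero_iff_forall_not_isIsogenous_of_isIsogenous hB' hB0' hB hB0 hX' hX]
  exact ⟨fun h q' q hq ↦ h q q' hq.symm', fun h q q' hq ↦ h q' q hq.symm'⟩

/-- `Hom(X, X')` is trivial iff `Hom(X', X)` is (perfect field). [cite: MumfordAV1970, §19 Cor. 1–2 of Thm. 1 (pp. 173–174)]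
[cite: Milne1986AbelianVarieties, §12 p. 122 (PDF p. 189)] -/
theorem subsingleton_hom_comm_of_perfectField (X X' : Motives.AbelianVariety K) : Subsingleton (X ⟶ X') ↔ Subsingleton (X' ⟶ X) := by
  have h : ∀ (A C : Motives.AbelianVariety K), Subsingleton (A ⟶ C) ↔ ∀ f : A ⟶ C, f = 0 := fun A C ↦
    ⟨fun hs f ↦ Subsingleton.elim f 0, fun hf ↦ ⟨fun f g ↦ by rw [hf f, hf g]⟩⟩
  rw [h, h, forall_hom_eq_zero_comm_of_perfectField]

/-- A simple factor test: `Hom(X, X') ≠ 0` iff SOME simple factor of `X` is isogenous to a simple factor of `X'` (perfect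
field). [cite: MumfordAV1970, §19 Cor. 1–2 of Thm. 1 (pp. 173–174)] [cite: Milne1986AbelianVarieties, §12 Prop. 12.1 and p. 122 (PDF p. 189)] -/
theorem exists_hom_ne_zero_iff_exists_isIsogenous (hB : ∀ q, (B q).IsSimple) (hB0 : ∀ q, 0 < (B q).dim)
    (hB' : ∀ q', (B' q').IsSimple) (hB0' : ∀ q', 0 < (B' q').dim)
    (hX : IsIsogenous X (⨁ fun q ↦ ⨁ fun _ : Fin (n q + 1) ↦ B q))
    (hX' : IsIsogenous X' (⨁ fun q' ↦ ⨁ fun _ : Fin (n' q' + 1) ↦ B' q')) :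
    (∃ f : X ⟶ X', f ≠ 0) ↔ ∃ q q', IsIsogenous (B q) (B' q') := by
  have h := forall_hom_eq_zero_iff_forall_not_isIsogenous_of_isIsogenous hB hB0 hB' hB0' hX hX'
  constructor
  · rintro ⟨f, hf⟩
    by_contra hne
    exact hf (h.2 (fun q q' hqq' ↦ hne ⟨q, q', hqq'⟩) f)
  · rintro ⟨q, q', hqq'⟩
    by_contra hne
    have h0 : ∀ f : X ⟶ X', f = 0 := fun f ↦ by
      by_contra hf
      exact hne ⟨f, hf⟩
    exact h.1 h0 q q' hqq'

/-- **One-sided orthogonality splits the endomorphism algebra of a product** (perfect field): `Hom(X, X') = 0` ⟹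
`End⁰(X ⊞ X') ≃ₐ[ℚ] End⁰(X) × End⁰(X')` (the tree's two-sided `nonempty_algEquiv_endAlgebra_biprod_prod` and the symmetry).
[cite: MumfordAV1970, §19 Cor. 2 of Thm. 1 and p. 174] [cite: Milne1986AbelianVarieties, §12 p. 122 (PDF p. 189)] -/
theorem nonempty_algEquiv_endAlgebra_biprod_prod_of_forall_hom_eq_zero (h : ∀ f : X ⟶ X', f = 0) :
    Nonempty ((X ⊞ X').endAlgebra ≃ₐ[ℚ] X.endAlgebra × X'.endAlgebra) :=
  nonempty_algEquiv_endAlgebra_biprod_prod h ((forall_hom_eq_zero_comm_of_perfectField X X').1 h)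

/-- `[End⁰(X ⊞ X') : ℚ] = [End⁰ X : ℚ] + [End⁰ X' : ℚ]` as soon as `Hom(X, X') = 0` (perfect field).
[cite: MumfordAV1970, §19 Cor. 2 of Thm. 1 and Cor. of Thm. 3 (pp. 174–176)] -/
theorem finrank_endAlgebra_biprod_of_forall_hom_eq_zero (h : ∀ f : X ⟶ X', f = 0) :
    Module.finrank ℚ (X ⊞ X').endAlgebra = Module.finrank ℚ X.endAlgebra + Module.finrank ℚ X'.endAlgebra :=
  finrank_endAlgebra_biprod_of_hom_eq_zero h ((forall_hom_eq_zero_comm_of_perfectField X X').1 h)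

end Perfect

end AbelianVariety

end Literature.AlgebraicGeometry.HodgeTheory

end
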